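import Literature.NumberTheory.Automorphic.UnitaryThreeTransvectionOrbitFrame     -- ★ p849293 (LH4-p01 (g2)): `exists_coe_eq_diagonal_mul_upperUnipotent_of_blockTriangular`, `exists_v_eq_v_zpow`; brings ★ p849269 RAO-REG-FRAME (`m_κ`, `n(a,s)`, `d(z)`)
import HarnessLib

/-!
# The upper-triangular normalisation `B = k · d(z)^j · m_κ · n(a,s)` for the regular unipotent orbit of `U(3)` («(A1)»)

Topic `NumberTheory/Automorphic`; namespace `Literature.NumberTheory.Automorphic.UnitaryGroup`.  THEOREMS ONLY (no definition, no instance, no notation,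
no named fact, no `sorry`).  Sibling of ★ `UnitaryThreeRegularUnipotentOrbitFrame` (RAO-REG-FRAME) and ★ `UnitaryThreeTransvectionOrbitFrame` (its
transvection twin): the ALGEBRA HALF of the covering `U(σ, J₀) = K₀ · d(z)^ℤ · m_κ · C_U(u₀)` used to bound the orbital integrals of the REGULAR unipotent
class `u₀ = !![1, 1, -t₀; 0, 1, -1; 0, 0, 1]` of the quasi-split unitary group in three variables [cite: Rogawski1990, §3.9 p. 32; §4.5 p. 45]
[cite: Rao1972, Thm. p. 505].

Given an upper triangular `B ∈ U(σ, J₀)` (`B₁₀ = B₂₀ = B₂₁ = 0`) over a discretely valued field with an involution `σ` preserving the valuation, a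
uniformiser-like `z` (`|z| = exp(−1)`) with torus element `d = diag(z, 1, (σz)⁻¹)`, and a traceless unit direction `ξ` (`σξ = −ξ`, `ξ ≠ 0`), the
theorem `exists_torusZpow_transversal_regCent_of_upperTriangular` writes
`B = k · d^j · m_κ · n(a,s)` with `k ∈ U(σ, J₀)` integral with integral inverse (indeed `k = diag(α₀, β, (σα₀)⁻¹)` with unit entries), `j ∈ ℤ` the
valuation of `B₀₀` (`|B₀₀| = exp(−j)`), `m_κ = !![1, κξ, κ²ξ²/2; 0, 1, κξ; 0, 0, 1]` the transversal (`σκ = κ`) and `n(a,s) = !![1, a, s − a²/2; 0, 1, −a; 0, 0, 1]`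
(`σa = a`, `σs = −s`) in the centraliser of `u₀`; and it reads off the corner entry of the conjugate:
`|(B u₀ B⁻¹)₀₂| = exp(−2j) · |t₀ + 2κξ|`.

Road: the Borel factor ★ `exists_coe_eq_diagonal_mul_upperUnipotent_of_blockTriangular` (`B = diag(α, β, (σα)⁻¹) · n′`), `|α| = |z|^j`
(★ `exists_v_eq_v_zpow`), `α = α₀ z^j`, the unitriangular factor `n′ ∈ U` splits as `m_κ · n(a,s)` (★ `exists_transversal_mul_regCent_of_mem`), and
`B u₀ B⁻¹ = T (m_κ u₀ m_κ⁻¹) T⁻¹` with `T = diag(α, β, (σα)⁻¹)` is read by ★ `coe_transversal_conj_regularUnipotent` and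
★ `coe_diagonal_conj_upperTriangularUnipotent`.
-/

set_option autoImplicit false

open Matrix
open scoped Valued WithZero

namespace Literature.NumberTheory.Automorphic.UnitaryGroup

open Literature.NumberTheory.Automorphic Literature.NumberTheory.Automorphic.HermitianLattice Literature.NumberTheory.Automorphic.UnitaryLatticeTree

variable {K : Type*} [Field K] (σ : K →+* K)

/-- An upper triangular `3 × 3` matrix (`B₁₀ = B₂₀ = B₂₁ = 0`) is block triangular for the identity block structure. [cite: Rogawski1990, §1.10 p. 9] -/
theorem blockTriangular_id_of_lower_eq_zero {B : Matrix (Fin 3) (Fin 3) K} (h10 : B 1 0 = 0) (h20 : B 2 0 = 0) (h21 : B 2 1 = 0) :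
    B.BlockTriangular id := by
  intro i j hij
  fin_cases i <;> fin_cases j <;> first | exact absurd hij (by decide) | assumption

section Valued

variable [Valued K ℤᵐ⁰]

/-- **(A1) THE UPPER-TRIANGULAR NORMALISATION `B = k · d(z)^j · m_κ · n(a,s)`** for the regular unipotent orbit frame of `U(σ, J₀)`: an upper triangular
`B ∈ U(σ, J₀)` factors as `k · d^j · m_κ · n(a,s)` with `k ∈ U(σ, J₀)` INTEGRAL WITH INTEGRAL INVERSE, `j : ℤ` determined by `|B₀₀| = exp(−j)`, `m_κ` the
transversal (`σκ = κ`) and `n(a,s)` (`σa = a`, `σs = −s`) in the centraliser of `u₀ = !![1, 1, -t₀; 0, 1, -1; 0, 0, 1]`; moreover the corner entry of the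
conjugate has `|(B u₀ B⁻¹)₀₂| = exp(−2j) · |t₀ + 2κξ|`.  Here `|z| = exp(−1)`, `d = diag(z, 1, (σz)⁻¹)`, `σξ = −ξ ≠ 0`, `2 ≠ 0`.
[cite: Rogawski1990, §3.9 p. 32; §4.5 p. 45] [cite: Rao1972, Thm. p. 505] -/
theorem exists_torusZpow_transversal_regCent_of_upperTriangular (hσ : ∀ z : K, σ (σ z) = z) (hσv : ∀ x, Valued.v (σ x) = Valued.v x) (h2 : (2 : K) ≠ 0)
    {z ξ t₀ : K} (hz : Valued.v z = WithZero.exp (-1 : ℤ)) (hξ : σ ξ = -ξ) (hξ0 : ξ ≠ 0) {d u B : GL (Fin 3) K}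
    (hd : (d : Matrix (Fin 3) (Fin 3) K) = Matrix.diagonal ![z, 1, (σ z)⁻¹]) (hu : (u : Matrix (Fin 3) (Fin 3) K) = !![1, 1, -t₀; 0, 1, -1; 0, 0, 1])
    (hB : B ∈ unitaryGroupOfForm σ ((StdForm.antidiagonal 3).over K))
    (h10 : (B : Matrix (Fin 3) (Fin 3) K) 1 0 = 0) (h20 : (B : Matrix (Fin 3) (Fin 3) K) 2 0 = 0) (h21 : (B : Matrix (Fin 3) (Fin 3) K) 2 1 = 0) :
    ∃ (j : ℤ) (κ a s : K) (k m n : GL (Fin 3) K), σ κ = κ ∧ σ a = a ∧ σ s = -s ∧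
      k ∈ unitaryGroupOfForm σ ((StdForm.antidiagonal 3).over K) ∧ IsIntMatrix (k : Matrix (Fin 3) (Fin 3) K) ∧
      IsIntMatrix ((k⁻¹ : GL (Fin 3) K) : Matrix (Fin 3) (Fin 3) K) ∧
      (m : Matrix (Fin 3) (Fin 3) K) = !![1, κ * ξ, κ ^ 2 * ξ ^ 2 / 2; 0, 1, κ * ξ; 0, 0, 1] ∧
      (n : Matrix (Fin 3) (Fin 3) K) = !![1, a, s - a ^ 2 / 2; 0, 1, -a; 0, 0, 1] ∧
      B = k * d ^ j * m * n ∧ Valued.v ((B : Matrix (Fin 3) (Fin 3) K) 0 0) = WithZero.exp (-j) ∧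
      Valued.v (((B * u * B⁻¹ : GL (Fin 3) K) : Matrix (Fin 3) (Fin 3) K) 0 2) = WithZero.exp (-2 * j) * Valued.v (t₀ + 2 * κ * ξ) := by
  -- the Borel factor `B = diag(α, β, (σα)⁻¹) · n′`
  obtain ⟨α, β, x, y, c, hα, hβ, hBD⟩ :=
    exists_coe_eq_diagonal_mul_upperUnipotent_of_blockTriangular σ hB (blockTriangular_id_of_lower_eq_zero h10 h20 h21)
  have hz0 : z ≠ 0 := (Valuation.ne_zero_iff _).1 (by rw [hz]; exact WithZero.coe_ne_zero)
  -- `α = α₀ z^j`, `|α₀| = 1`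
  obtain ⟨j, hj⟩ := exists_v_eq_v_zpow hz hα
  obtain ⟨α₀, hα₀_def⟩ : ∃ α₀ : K, α₀ = α * (z ^ j)⁻¹ := ⟨_, rfl⟩
  have hzj : z ^ j ≠ 0 := zpow_ne_zero j hz0
  have hα₀ : α₀ ≠ 0 := by rw [hα₀_def]; exact mul_ne_zero hα (inv_ne_zero hzj)
  have hvα₀ : Valued.v α₀ = 1 := by
    rw [hα₀_def, map_mul, map_inv₀, map_zpow₀, hj, mul_inv_cancel₀ (zpow_ne_zero j ((Valuation.ne_zero_iff _).2 hz0))]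
  have hαeq : α = α₀ * z ^ j := by rw [hα₀_def, inv_mul_cancel_right₀ hzj]
  have hβ0 : β ≠ 0 := fun h0 => by rw [h0, mul_zero] at hβ; exact zero_ne_one hβ
  have hvβ : Valued.v β = 1 := by
    -- `|β|² = 1` in the value group (cf. ★ `v_eq_one_of_map_mul_self_eq_one` of `UnitaryLatticeTreeFramesOfInvolution`, not imported here to keep the file light)
    have h : Valued.v β * Valued.v β = 1 := by have h := congrArg Valued.v hβ; rwa [map_mul, map_one, hσv] at h
    rcases le_total (Valued.v β) 1 with h1 | h1
    · exact le_antisymm h1 (calc (1 : ℤᵐ⁰) = Valued.v β * Valued.v β := h.symm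
        _ ≤ Valued.v β * 1 := mul_le_mul' le_rfl h1
        _ = Valued.v β := mul_one _)
    · exact le_antisymm (calc Valued.v β = Valued.v β * 1 := (mul_one _).symm
        _ ≤ Valued.v β * Valued.v β := mul_le_mul' le_rfl h1
        _ = 1 := h) h1
  have hσα₀ : σ α₀ ≠ 0 := (map_ne_zero σ).2 hα₀
  have hσα : σ α ≠ 0 := (map_ne_zero σ).2 hα
  -- the units `k₁ = diag(α₀, 1, (σα₀)⁻¹)`, `m_β = diag(1, β, 1)`, `n′`
  obtain ⟨k₁, hk₁, hk₁'⟩ := exists_units_coe_eq_torusElt σ hα₀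
  obtain ⟨mβ, hmβ, hmβ'⟩ := exists_units_coe_eq_torusS (K := K) one_ne_zero hβ0
  obtain ⟨n₁, hn₁, -⟩ := exists_units_coe_eq_upperTriangularUnipotent x y c
  -- `T := k₁ · m_β · d^j = diag(α, β, (σα)⁻¹)`
  have hT : ((k₁ * mβ * d ^ j : GL (Fin 3) K) : Matrix (Fin 3) (Fin 3) K) = Matrix.diagonal ![α, β, (σ α)⁻¹] := by
    rw [Units.val_mul, Units.val_mul, hk₁, hmβ, coe_torusElt_zpow σ hz0 hd j, Matrix.diagonal_mul_diagonal, Matrix.diagonal_mul_diagonal, hαeq,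
      map_mul, map_zpow₀]
    congr 1
    funext i; fin_cases i
    · simp
    · simp
    · simp [mul_comm]
  have hBprod : B = k₁ * mβ * d ^ j * n₁ := by
    refine Units.ext ?_
    rw [Units.val_mul, hT, hn₁, hBD]
  -- memberships in `U(σ, J₀)`
  have hk₁U : k₁ ∈ unitaryGroupOfForm σ ((StdForm.antidiagonal 3).over K) := torusElt_mem_unitaryGroupOfForm σ hα₀ (hσ α₀) hk₁
  have hdU : d ∈ unitaryGroupOfForm σ ((StdForm.antidiagonal 3).over K) := torusElt_mem_unitaryGroupOfForm σ hz0 (hσ z) hd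
  have hmβU : mβ ∈ unitaryGroupOfForm σ ((StdForm.antidiagonal 3).over K) :=
    (diagonal_mem_unitaryGroupOfForm_three_iff σ hmβ).2 ⟨by rw [map_one, one_mul], hβ, by rw [map_one, one_mul]⟩
  have hn₁U : n₁ ∈ unitaryGroupOfForm σ ((StdForm.antidiagonal 3).over K) := by
    have h : n₁ = (d ^ j)⁻¹ * (mβ⁻¹ * (k₁⁻¹ * B)) := by rw [hBprod]; group
    rw [h]
    exact mul_mem (inv_mem (zpow_mem hdU j)) (mul_mem (inv_mem hmβU) (mul_mem (inv_mem hk₁U) hB))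
  -- the unitriangular factor splits: `n′ = m_κ · n(a,s)`
  obtain ⟨m, n, κ, a, s, hκ, ha, hs, -, -, hm, hn, hn₁mn⟩ := exists_transversal_mul_regCent_of_mem σ hσ h2 hξ hξ0 hn₁ hn₁U
  have hnu : n * u = u * n := (regCentElt_mem_and_commute σ hσ h2 ha hs hu hn).2
  refine ⟨j, κ, a, s, k₁ * mβ, m, n, hκ, ha, hs, mul_mem hk₁U hmβU, ?_, ?_, hm, hn, ?_, ?_, ?_⟩
  · -- `k = diag(α₀, β, (σα₀)⁻¹)` integral
    rw [Units.val_mul, hk₁, hmβ, Matrix.diagonal_mul_diagonal]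
    have e : (fun i => (![α₀, 1, (σ α₀)⁻¹] : Fin 3 → K) i * (![1, β, 1] : Fin 3 → K) i) = ![α₀, β, (σ α₀)⁻¹] := by
      funext i; fin_cases i <;> simp
    rw [e]
    exact isIntMatrix_diagonal_three hvα₀.le hvβ.le (by rw [map_inv₀, hσv, hvα₀, inv_one])
  · -- `k⁻¹ = diag(α₀⁻¹, β⁻¹, σα₀)` integral
    rw [_root_.mul_inv_rev, Units.val_mul, hmβ', hk₁', Matrix.diagonal_mul_diagonal]
    have e : (fun i => (![(1 : K)⁻¹, β⁻¹, 1⁻¹] : Fin 3 → K) i * (![α₀⁻¹, 1, σ α₀] : Fin 3 → K) i) = ![α₀⁻¹, β⁻¹, σ α₀] := by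
      funext i; fin_cases i <;> simp
    rw [e]
    exact isIntMatrix_diagonal_three (by rw [map_inv₀, hvα₀, inv_one]) (by rw [map_inv₀, hvβ, inv_one]) (by rw [hσv, hvα₀])
  · -- `B = k · d^j · m · n`
    rw [hBprod, hn₁mn, ← mul_assoc]
  · -- `|B₀₀| = |α| = exp(−j)`
    have hB00 : (B : Matrix (Fin 3) (Fin 3) K) 0 0 = α := by
      rw [hBD]; simp [Matrix.mul_apply, Fin.sum_univ_three]
    rw [hB00, hj, hz, ← WithZero.exp_zsmul, smul_eq_mul, mul_neg, mul_one]
  · -- `B u B⁻¹ = T (m u m⁻¹) T⁻¹`, corner entry `α (−t₀ − 2κξ) σα`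
    have hBT : B = (k₁ * mβ * d ^ j) * m * n := by rw [hBprod, hn₁mn, ← mul_assoc]
    have hconj : B * u * B⁻¹ = (k₁ * mβ * d ^ j) * (m * u * m⁻¹) * (k₁ * mβ * d ^ j)⁻¹ := by
      have h1 : (k₁ * mβ * d ^ j) * m * n * u = (k₁ * mβ * d ^ j) * m * u * n := by simp only [mul_assoc, hnu]
      rw [hBT, h1]; group
    have hmu := coe_transversal_conj_regularUnipotent (K := K) hm hu
    have hcoe := coe_diagonal_conj_upperTriangularUnipotent hα hβ0 (inv_ne_zero hσα) hT hmu
    have e02 : (((B * u * B⁻¹ : GL (Fin 3) K) : Matrix (Fin 3) (Fin 3) K) 0 2) = α * (-t₀ - 2 * κ * ξ) * ((σ α)⁻¹)⁻¹ := by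
      rw [hconj, hcoe]; rfl
    have hvα : Valued.v α = WithZero.exp (-j) := by rw [hj, hz, ← WithZero.exp_zsmul, smul_eq_mul, mul_neg, mul_one]
    rw [e02, inv_inv, map_mul, map_mul, hσv, hvα, show -t₀ - 2 * κ * ξ = -(t₀ + 2 * κ * ξ) by ring, Valuation.map_neg, mul_right_comm,
      ← WithZero.exp_add]
    congr 2; ring

end Valued

end Literature.NumberTheory.Automorphic.UnitaryGroup
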